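import Literature.NumberTheory.Multiplicative.CorradiKatai1969.Defs

/-!
# Corrádi–Kátai (1969): sanity instances for "character-type" (`IsCharacterTypeMod`, `IsCharacterType`)

Review evidence for the pub-refute REVIEW-RUNBOOK (ops-runbook sanity registry `registry/pub-refute.json`);
no new definitions.  [CorradiKatai1969, p. 25]: `f` is of *character-type* (mod `K`) when `f m = f n` for
`m ≡ n (mod K)`, `(n, K) = 1` — the behaviour of a Dirichlet character to the modulus `K` on the residues
prime to `K`.

* holds: every Dirichlet character mod `K` (Mathlib `DirichletCharacter ℤ K`) is of character-type mod `K`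
  (agreement with the Mathlib notion the name alludes to); constants are of character-type to every modulus,
  hence `IsCharacterType` is satisfiable; mod `1` the condition says "constant on `ℕ≥1`";
* fails: the tree's `not_isCharacterType_fCE` (module `.Density`) is the substantive fails-instance — the
  Corrádi–Kátai counterexample function is not of character-type; (trivially, neither is `n ↦ n`: `1 ≡ 3 (2)`,
  `(3,2) = 1`, `1 ≠ 3` — not filed here, Literature holds cited statements only).
-/

namespace Literature.NumberTheory.Multiplicative.CorradiKatai1969

/-- A constant function is of character-type to every modulus. [cite: CorradiKatai1969, p. 25] -/
theorem isCharacterTypeMod_const (c : ℤ) (K : ℕ) : IsCharacterTypeMod (fun _ => c) K :=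
  fun _ _ _ _ _ _ => rfl

/-- Hence constants are of character-type (`K = 1` works): `IsCharacterType` is satisfiable.
[cite: CorradiKatai1969, p. 25] -/
theorem isCharacterType_const (c : ℤ) : IsCharacterType (fun _ => c) :=
  ⟨1, le_rfl, isCharacterTypeMod_const c 1⟩

/-- **Agreement with Mathlib's Dirichlet characters**: a Dirichlet character `χ` mod `K` with values in `ℤ`
(read on `ℕ` through `ℕ → ZMod K`) is of character-type mod `K` — congruent arguments have equal values
(no coprimality needed for this direction). [cite: CorradiKatai1969, p. 25] -/
theorem isCharacterTypeMod_dirichletCharacter (K : ℕ) (χ : DirichletCharacter ℤ K) :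
    IsCharacterTypeMod (fun n => χ (n : ZMod K)) K := by
  intro m n _ _ hmn _
  simp only [(ZMod.natCast_eq_natCast_iff' m n K).mpr hmn]

/-- To the modulus `1` every pair of positive integers is congruent and coprime to the modulus, so
character-type mod `1` means: constant on `ℕ≥1`. [cite: CorradiKatai1969, p. 25] -/
theorem isCharacterTypeMod_one_iff (f : ℕ → ℤ) :
    IsCharacterTypeMod f 1 ↔ ∀ m n, 1 ≤ m → 1 ≤ n → f m = f n := by
  refine ⟨fun h m n hm hn => h m n hm hn ?_ (Nat.coprime_one_right n), fun h m n hm hn _ _ => h m n hm hn⟩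
  simp [Nat.mod_one]

end Literature.NumberTheory.Multiplicative.CorradiKatai1969
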